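import Summits.HodgeConjecture.HodgeConjecture.Theorems.SixfoldTableXCensusRow21CodimThree
import Summits.HodgeConjecture.Ring2.RowFourClosed
import Literature.AlgebraicGeometry.HodgeTheory.UnitaryTwoOneTimesCMCurveWeilClasses
import Literature.AlgebraicGeometry.HodgeTheory.HodgeConjectureIsogenyInvariance
import Literature.AlgebraicGeometry.HodgeTheory.HardLefschetzNFoldHolds
import Literature.AlgebraicGeometry.HodgeTheory.AlgebraicClassesCupAbelianVariety
import Literature.AlgebraicGeometry.HodgeTheory.AbelianVarietyPullbackAlgebraicClasses
import HarnessLib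

/-!
# TABLE X (dimension 6) — row 21 `g6.E3xY3.(2,1)`: THE HODGE CONJECTURE FOR EVERY `A ∼ Y₃ × E³` FOLLOWS FROM THE HODGE
# CONJECTURE FOR THE ONE ABELIAN FOURFOLD `Y₃ × E` (kernel), hence from Markman's fourfold theorem (displayed binder)
# (cell `pub-hodgeav-hg6`, req-37 (A) Q2b; eng-2 g7, lead g3 staffing note 2026-08-29T05:14:03Z; RECORD lane)

HONEST FRAMING. HC, `HC_AV` (stmt-1333), `HC_CM` (stmt-3052) and the rung H2 are NOT proved and do not occur here. The ONLY
print binder of this module is the tree's named fact `Markman2025_weilClasses_algebraic_abelianFourfold`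
(`HodgeTheory/WeilClassesFourfolds`: the Weil classes of every complex abelian fourfold of Weil type are algebraic — E. Markman,
arXiv:2502.03415, Thm. 1.5.1 / Cor. 1.6.1 [corpus: paper:arxiv-2502.03415 p7]; preprint, under review), and it is DISPLAYED as a
hypothesis of the §3 corollaries, never discharged. §1–§2 are UNCONDITIONAL kernel theorems. KIND of `HC_CM`: ABSENT. No definition,
no `sorry`, no new named fact; typed ≠ proved.

WHY THIS MODULE. After the census programme γ2 (eng-2 g6) TABLE X row 21 (`HOME/TABLE-X-g6-v0.md` §1: `X ∼ E_k³ × Y₃`, `Y₃` of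
unitary type `(2,1)` over `k = ℚ(√-d) = End⁰(Y₃)`, `E` an elliptic curve with complex multiplication) carries two KERNEL span
theorems for its model `Y × ((E × E) × E)`:
* codimension two (Literature `mem_divisorClassesSpan_sup_span_pullbacks_of_unitaryTwoOne_cmCurve_cube`, p689540):
  `B²(Y × E³) ⊆ D² + Σ_{a=1}^{3} α_a^* B²(Y × E)`, `α_a = 𝟙 × q_a` the three surjections onto the FOURFOLD `Y × E`;
* codimension three (Literature `mem_divisorClassesSpan_sup_span_cup_of_unitaryTwoOne_cmCurve_cube_codimThree`, p696841):
  `B³(Y × E³) ⊆ D³ ⊔ span{a ⌣ b : a ∈ B², b ∈ B¹}`;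
and the row stays on the cell's «theorem-less floor» only for HC itself (lead g3 STATUS l.507: available routes = the Markman₄
binder of the cover, Abdulali 2012 Thm. 14 for `k ∈ {ℚ(i), ℚ(√-3)}` — `SixfoldTableXRow21OfAbdulali`, p687758 —, Floccari–Fu 2026).
THIS FILE types the first route at the sharpest level the two span theorems allow: the Hodge conjecture for the sixfold is
REDUCED IN THE KERNEL to the Hodge conjecture for the single abelian fourfold `Y × E`, and the latter is what Markman's
fourfold theorem (through the tree's floor `Ring2.RowFourClosed.hcUpToDim_five_of_markman` — Moonen–Zarhin's `dim ≤ 5`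
theorem modulo Markman, a kernel theorem of cell `pub-hodge-ring2`) supplies.

* §1 `hodgeConjectureFor_of_dim_le_six_of_codim_two_three` — for ANY complex abelian variety of dimension `≤ 6`, the Hodge
  conjecture follows from its codimension-`2` and codimension-`3` cases (codimension `0`: the unit class; `1`: Lefschetz
  `(1,1)`; `≥ 4`: hard-Lefschetz duality `mem_algebraicClasses_of_lt_of_nonempty`). Row-independent glue.
* §2 **`hodgeConjectureFor_unitaryTwoOne_prod_cmCurveCube_of_fourfold`** — KERNEL, UNCONDITIONAL IMPLICATION: for `Y` a complex
  abelian threefold with `dim_ℚ End⁰(Y) = 2`, `φ ≫ φ = -d` (`d > 0`) of multiplicity `1` at `i√d` or `-i√d`, and `E` an elliptic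
  curve with `χ ≫ χ = -d'` (`d' > 0`; ANY `d, d'`): `HodgeConjectureFor (Y × E) ⟹ HodgeConjectureFor (Y × ((E × E) × E))`
  (codimension 2: divisor monomials are algebraic and pull-backs of ALGEBRAIC classes of `Y × E` are algebraic,
  `map_mem_algebraicClasses_of_abelianVariety`; codimension 3: `(algebraic (2,2)) ⌣ (divisor)` is algebraic,
  `AbelianVariety.cupProduct_mem_algebraicClasses_one`; then §1); `hodgeConjectureFor_row21_of_fourfold` /
  `hodgeConjectureFor_row21_of_fourfold'` — the same at every `A ∼ Y × ((E × E) × E)`, resp. `A ∼ E³ × Y`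
  (`HodgeConjectureFor.of_isIsogenous`, van Geemen Lemma 3.7).
* §3 **`hodgeConjectureFor_row21_of_markman`** (+ `'`, + the `HCOnClass` spelling `hcOnClass_row21_of_markman`) — TABLE X ROW 21,
  ALL MEMBERS, MODULO THE ONE DISPLAYED BINDER Markman₄: the fourfold `Y × E` has dimension `4 ≤ 5`, so the floor gives
  `HodgeConjectureFor (Y × E)`, and §2 applies. For `d = d'` the tree also has the fourfold statement directly
  (`hodgeConjectureFor_prod_cmCurve_of_unitaryTwoOne_of_weilClassesFourfold`, Moonen–Zarhin case (a1) `B(Y × E) = D + W_k`):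
  `hodgeConjectureFor_unitaryTwoOne_prod_cmCurveCube_of_markman_sameField` records that reading (Markman enters ONLY through
  the Weil classes of `Y × E_k` itself).

READING (honest scope; three-clause form). (i) KERNEL: «HC at every member of row 21 ⟸ HC of the one abelian fourfold `Y × E`»,
an unconditional implication, std axioms; (ii) HC at row 21 MODULO the displayed binder Markman₄ (preprint, under review;
for `d = d' ∈ {1, 3}` the refereed Abdulali binder of p687758 is an alternative; the Floccari–Fu all-`d` route is NOT
formalised); (iii) NOT proved: Markman₄, HC / `HC_AV` / `HC_CM` / H2; `D² ≠ B²` for the row is not asserted; no inhabitant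
is exhibited and none is invented. All declarations live in `TableX.ProductRows` (lead g2 DEDUP RULE). Nothing here is a
corollary of `HC_CM`; typed ≠ proved.
-/

set_option linter.dupNamespace false

noncomputable section

open CategoryTheory
open Literature.AlgebraicGeometry Literature.AlgebraicGeometry.Motives
open Literature.AlgebraicGeometry.Motives.AbelianVariety (IsIsogenous powSucc powSucc_zero powSucc_succ)
open Literature.AlgebraicGeometry.HodgeTheory
open Literature.AlgebraicGeometry.Milne1999
open Literature.AlgebraicTopology.SingularHomology
open Literature.Barriers.HodgeConjecture
open Summit.HodgeConjecture.HodgeConjecture.Ring2.ClassTargets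

namespace Summit.HodgeConjecture.HodgeConjecture.TableX.ProductRows

/-! ## §1 Glue: on an abelian variety of dimension `≤ 6`, HC follows from codimensions `2` and `3` -/

/-- **The Hodge conjecture for a complex abelian variety of dimension `≤ 6` from its codimension-`2` and codimension-`3`
cases.** Codimension `0` is the unit class (`hodgeConjectureFor_codim_zero`), codimension `1` is Lefschetz `(1,1)`
(`lefschetzOneOne_rational_holds`), and every codimension `p` with `2p > dim` is reduced to codimension `dim - p ≤ 3` by the
hard-Lefschetz isomorphism `L^{2p - dim}` (which is algebraic and bijective on Hodge classes: the tree's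
`mem_algebraicClasses_of_lt_of_nonempty` with `nonempty_hardLefschetzNFold_holds`). [cite: VoisinHodgeI2002, Thms. 6.25, 11.30]
[cite: MoonenZarhin1999LowDim, §5 (5.1)] -/
theorem hodgeConjectureFor_of_dim_le_six_of_codim_two_three (X : AbelianVariety ℂ) (h6 : X.dim ≤ 6)
    (hp2 : ∀ c : complexBetti X.X (2 * 2), IsRationalClass c → IsOfHodgeType X.dim X.X (2 * 2) 2 2 c →
      c ∈ algebraicClasses X.X 2)
    (hp3 : ∀ c : complexBetti X.X (2 * 3), IsRationalClass c → IsOfHodgeType X.dim X.X (2 * 3) 3 3 c →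
      c ∈ algebraicClasses X.X 3) :
    HodgeConjectureFor X.dim X.X := by
  have hX : IsSmoothProjective X.dim X.X := AbelianVariety.isSmoothProjective_holds
  have h11 : ∀ b : complexBetti X.X (2 * 1), IsRationalClass b →
      IsOfHodgeType X.dim X.X (2 * 1) 1 1 b → b ∈ algebraicClasses X.X 1 :=
    fun b hb hbt ↦ lefschetzOneOne_rational_holds hX b hb hbt
  have hlow : ∀ p : ℕ, p ≤ 3 → ∀ c : complexBetti X.X (2 * p), IsRationalClass c →
      IsOfHodgeType X.dim X.X (2 * p) p p c → c ∈ algebraicClasses X.X p := by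
    intro p hp c hc hct
    interval_cases p
    · exact hodgeConjectureFor_codim_zero c
    · exact h11 c hc hct
    · exact hp2 c hc hct
    · exact hp3 c hc hct
  refine ⟨nonempty_hodgeModel_holds hX, fun p c hc hct ↦ ?_⟩
  by_cases hp : p ≤ 3
  · exact hlow p hp c hc hct
  · exact mem_algebraicClasses_of_lt_of_nonempty (nonempty_hardLefschetzNFold_holds X.dim X.X) hX
      (by omega) (hlow (X.dim - p) (by omega)) c hc hct

/-! ## §2 Row 21: HC for `Y × ((E × E) × E)` from HC for the fourfold `Y × E` (kernel, unconditional implication) -/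

section Row21

variable {Y E : AbelianVariety ℂ}

/-- **TABLE X row 21, KERNEL REDUCTION: the Hodge conjecture for the ONE abelian fourfold `Y × E` implies the Hodge conjecture
for the sixfold `Y × ((E × E) × E)`.** Here `Y` is a complex abelian threefold with `dim_ℚ End⁰(Y) = 2` and `φ ≫ φ = -d`
(`d > 0`) of multiplicity `1` at `i√d` or at `-i√d` (unitary type `(2,1)` over `ℚ(√-d) = End⁰(Y)`), `E` an elliptic curve
with complex multiplication `χ ≫ χ = -d'` (`d' > 0`; no relation between `d` and `d'` is needed). Codimension two:
`B² ⊆ D² + Σ_a α_a^* B²(Y × E)` (`mem_divisorClassesSpan_sup_span_pullbacks_of_unitaryTwoOne_cmCurve_cube`), divisor monomials are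
algebraic (`AbelianVariety.divisorClassesSpan_le_algebraicClasses` over Lefschetz `(1,1)`) and the pull-back of an ALGEBRAIC class
of `Y × E` is algebraic (`map_mem_algebraicClasses_of_abelianVariety`); codimension three: `B³ ⊆ D³ ⊔ span{(2,2) ⌣ (1,1)}`
(`mem_divisorClassesSpan_sup_span_cup_of_unitaryTwoOne_cmCurve_cube_codimThree`) and `(algebraic) ⌣ (divisor)` is algebraic
(`AbelianVariety.cupProduct_mem_algebraicClasses_one`); the other codimensions by §1. UNCONDITIONAL; HC for `Y × E` is the
HYPOTHESIS `h4`, not asserted. [cite: MoonenZarhin1999LowDim, Thm. 0.2 (1) with cases (a), (e) and §5 (5.3), (5.12)]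
[cite: VoisinHodgeI2002, Thms. 6.25, 11.30] [cite: Fulton1998, §19.2 Cor. 19.2 (b)] -/
theorem hodgeConjectureFor_unitaryTwoOne_prod_cmCurveCube_of_fourfold (hY3 : Y.dim = 3)
    (hY2 : Module.finrank ℚ Y.endAlgebra = 2) (φ : Y ⟶ Y) {d : ℕ} (hd : 0 < d) (hφ : φ ≫ φ = -(d • 𝟙 Y))
    (hm1 : eigenMultiplicity Y φ (Complex.I * (Real.sqrt d : ℂ)) = 1 ∨
      eigenMultiplicity Y φ (-(Complex.I * (Real.sqrt d : ℂ))) = 1)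
    (hE1 : E.dim = 1) (χ : E ⟶ E) {d' : ℕ} (hd' : 0 < d') (hχ : χ ≫ χ = -(d' • 𝟙 E))
    (h4 : HodgeConjectureFor (Y.prod E).dim (Y.prod E).X) :
    HodgeConjectureFor (Y.prod ((E.prod E).prod E)).dim (Y.prod ((E.prod E).prod E)).X := by
  have hdim6 : (Y.prod ((E.prod E).prod E)).dim = 6 := by
    rw [Motives.AbelianVariety.dim_prod, Motives.AbelianVariety.dim_prod, Motives.AbelianVariety.dim_prod, hY3, hE1]
  have hX : IsSmoothProjective (Y.prod ((E.prod E).prod E)).dim (Y.prod ((E.prod E).prod E)).X :=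
    AbelianVariety.isSmoothProjective_holds
  have h11 : ∀ b : complexBetti (Y.prod ((E.prod E).prod E)).X (2 * 1), IsRationalClass b →
      IsOfHodgeType (Y.prod ((E.prod E).prod E)).dim (Y.prod ((E.prod E).prod E)).X (2 * 1) 1 1 b →
        b ∈ algebraicClasses (Y.prod ((E.prod E).prod E)).X 1 :=
    fun b hb hbt ↦ lefschetzOneOne_rational_holds hX b hb hbt
  -- codimension two: divisors + pull-backs of algebraic classes of the fourfold `Y × E`
  have hp2 : ∀ c : complexBetti (Y.prod ((E.prod E).prod E)).X (2 * 2), IsRationalClass c →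
      IsOfHodgeType (Y.prod ((E.prod E).prod E)).dim (Y.prod ((E.prod E).prod E)).X (2 * 2) 2 2 c →
        c ∈ algebraicClasses (Y.prod ((E.prod E).prod E)).X 2 := by
    intro c hc hct
    refine (sup_le (AbelianVariety.divisorClassesSpan_le_algebraicClasses (Y.prod ((E.prod E).prod E)) h11 2)
      (Submodule.span_le.mpr ?_))
      (mem_divisorClassesSpan_sup_span_pullbacks_of_unitaryTwoOne_cmCurve_cube hY3 hY2 φ hd hφ hm1 hE1 χ hd' hχ hc hct)
    rintro _ ⟨q, w, -, hw, hwt, rfl⟩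
    exact map_mem_algebraicClasses_of_abelianVariety hX (Y.prod E) _ (h4.2 2 w hw hwt)
  -- codimension three: divisors + (algebraic (2,2)) ⌣ (divisor)
  have hp3 : ∀ c : complexBetti (Y.prod ((E.prod E).prod E)).X (2 * 3), IsRationalClass c →
      IsOfHodgeType (Y.prod ((E.prod E).prod E)).dim (Y.prod ((E.prod E).prod E)).X (2 * 3) 3 3 c →
        c ∈ algebraicClasses (Y.prod ((E.prod E).prod E)).X 3 := by
    intro c hc hct
    refine (sup_le (AbelianVariety.divisorClassesSpan_le_algebraicClasses (Y.prod ((E.prod E).prod E)) h11 3)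
      (Submodule.span_le.mpr ?_))
      (mem_divisorClassesSpan_sup_span_cup_of_unitaryTwoOne_cmCurve_cube_codimThree hY3 hY2 φ hd hφ hm1 hE1 χ hd' hχ
        hc hct)
    rintro _ ⟨a, b, ha, hat, hb, hbt, rfl⟩
    exact AbelianVariety.cupProduct_mem_algebraicClasses_one (Y.prod ((E.prod E).prod E)) (hp2 a ha hat) (h11 b hb hbt)
  exact hodgeConjectureFor_of_dim_le_six_of_codim_two_three _ hdim6.le hp2 hp3

/-- **TABLE X ROW 21 `g6.E3xY3.(2,1)`, ALL MEMBERS, from the fourfold (kernel):** for `Y`, `E` as above and every `A` isogenous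
to `Y × ((E × E) × E)`, the Hodge conjecture for the abelian fourfold `Y × E` implies the Hodge conjecture for `A`
(§2 and van Geemen's Lemma 3.7 `HodgeConjectureFor.of_isIsogenous`). UNCONDITIONAL implication; HC for `Y × E` is displayed,
not asserted. [cite: MoonenZarhin1999LowDim, Thm. 0.2 (1) and §5 (5.12)] [cite: vanGeemen1994HodgeAV, Lemma 3.7 (p. 236)] -/
theorem hodgeConjectureFor_row21_of_fourfold {A : AbelianVariety ℂ} (hY3 : Y.dim = 3)
    (hY2 : Module.finrank ℚ Y.endAlgebra = 2) (φ : Y ⟶ Y) {d : ℕ} (hd : 0 < d) (hφ : φ ≫ φ = -(d • 𝟙 Y))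
    (hm1 : eigenMultiplicity Y φ (Complex.I * (Real.sqrt d : ℂ)) = 1 ∨
      eigenMultiplicity Y φ (-(Complex.I * (Real.sqrt d : ℂ))) = 1)
    (hE1 : E.dim = 1) (χ : E ⟶ E) {d' : ℕ} (hd' : 0 < d') (hχ : χ ≫ χ = -(d' • 𝟙 E))
    (h4 : HodgeConjectureFor (Y.prod E).dim (Y.prod E).X) (hA : IsIsogenous A (Y.prod ((E.prod E).prod E))) :
    HodgeConjectureFor A.dim A.X :=
  HodgeConjectureFor.of_isIsogenous hA
    (hodgeConjectureFor_unitaryTwoOne_prod_cmCurveCube_of_fourfold hY3 hY2 φ hd hφ hm1 hE1 χ hd' hχ h4)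

/-- **Row 21 in the order `A ∼ E³ × Y`** (`E.powSucc 2 = (E × E) × E`; commutativity of `×` up to isogeny,
`isIsogenous_prod_comm`), from the fourfold. UNCONDITIONAL implication. [cite: vanGeemen1994HodgeAV, Lemma 3.7 (p. 236)]
[cite: Milne1986AbelianVarieties, §12 Prop. 12.1 and p. 122] -/
theorem hodgeConjectureFor_row21_of_fourfold' {A : AbelianVariety ℂ} (hY3 : Y.dim = 3)
    (hY2 : Module.finrank ℚ Y.endAlgebra = 2) (φ : Y ⟶ Y) {d : ℕ} (hd : 0 < d) (hφ : φ ≫ φ = -(d • 𝟙 Y))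
    (hm1 : eigenMultiplicity Y φ (Complex.I * (Real.sqrt d : ℂ)) = 1 ∨
      eigenMultiplicity Y φ (-(Complex.I * (Real.sqrt d : ℂ))) = 1)
    (hE1 : E.dim = 1) (χ : E ⟶ E) {d' : ℕ} (hd' : 0 < d') (hχ : χ ≫ χ = -(d' • 𝟙 E))
    (h4 : HodgeConjectureFor (Y.prod E).dim (Y.prod E).X) (hA : IsIsogenous A ((E.powSucc 2).prod Y)) :
    HodgeConjectureFor A.dim A.X :=
  hodgeConjectureFor_row21_of_fourfold hY3 hY2 φ hd hφ hm1 hE1 χ hd' hχ h4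
    (hA.trans (isIsogenous_prod_comm (E.powSucc 2) Y))

/-! ## §3 Row 21 modulo the ONE displayed binder: Markman's fourfold theorem -/

/-- **TABLE X ROW 21 `g6.E3xY3.(2,1)`, ALL MEMBERS, MODULO MARKMAN'S FOURFOLD THEOREM (displayed binder, the only one):**
for `Y` a complex abelian threefold with `dim_ℚ End⁰(Y) = 2` and `φ ≫ φ = -d` (`d > 0`) of multiplicity `1` at `± i√d`, `E` an
elliptic curve with `χ ≫ χ = -d'` (`d' > 0`; ANY `d, d'`), and every `A` isogenous to `Y × ((E × E) × E)`, the Hodge conjecture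
holds for `A` — GRANTED the named fact `Markman2025_weilClasses_algebraic_abelianFourfold` (hypothesis `hMark₄`, never
discharged): the fourfold `Y × E` has dimension `4 ≤ 5`, so the tree's floor `Ring2.RowFourClosed.hcUpToDim_five_of_markman`
(Moonen–Zarhin's `dim ≤ 5` theorem modulo Markman, a kernel theorem) gives `HodgeConjectureFor (Y × E)`, and §2 applies.
CONDITIONAL on the displayed binder; HC / `HC_AV` NOT proved. [claim: Markman2025SurveySecant, status: under-review]
[cite: Markman2025SecantWeil, Thm. 1.5.1 and Cor. 1.6.1] [cite: MoonenZarhin1999LowDim, Thm. 0.1 and Thm. 0.2 (1)]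
[cite: vanGeemen1994HodgeAV, Lemma 3.7 (p. 236)] -/
theorem hodgeConjectureFor_row21_of_markman (hMark₄ : Markman2025_weilClasses_algebraic_abelianFourfold)
    {A : AbelianVariety ℂ} (hY3 : Y.dim = 3) (hY2 : Module.finrank ℚ Y.endAlgebra = 2) (φ : Y ⟶ Y) {d : ℕ} (hd : 0 < d)
    (hφ : φ ≫ φ = -(d • 𝟙 Y))
    (hm1 : eigenMultiplicity Y φ (Complex.I * (Real.sqrt d : ℂ)) = 1 ∨
      eigenMultiplicity Y φ (-(Complex.I * (Real.sqrt d : ℂ))) = 1)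
    (hE1 : E.dim = 1) (χ : E ⟶ E) {d' : ℕ} (hd' : 0 < d') (hχ : χ ≫ χ = -(d' • 𝟙 E))
    (hA : IsIsogenous A (Y.prod ((E.prod E).prod E))) : HodgeConjectureFor A.dim A.X :=
  hodgeConjectureFor_row21_of_fourfold hY3 hY2 φ hd hφ hm1 hE1 χ hd' hχ
    (Ring2.RowFourClosed.hcUpToDim_five_of_markman hMark₄ (Y.prod E)
      (show (Y.prod E).dim ≤ 5 by rw [Motives.AbelianVariety.dim_prod, hY3, hE1]; norm_num))
    hA

/-- **Row 21 in the order `A ∼ E³ × Y`, MODULO Markman's fourfold theorem** (displayed binder). CONDITIONAL; HC / `HC_AV`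
NOT proved. [claim: Markman2025SurveySecant, status: under-review] [cite: MoonenZarhin1999LowDim, Thm. 0.2 (1)]
[cite: Milne1986AbelianVarieties, §12 Prop. 12.1 and p. 122] -/
theorem hodgeConjectureFor_row21_of_markman' (hMark₄ : Markman2025_weilClasses_algebraic_abelianFourfold)
    {A : AbelianVariety ℂ} (hY3 : Y.dim = 3) (hY2 : Module.finrank ℚ Y.endAlgebra = 2) (φ : Y ⟶ Y) {d : ℕ} (hd : 0 < d)
    (hφ : φ ≫ φ = -(d • 𝟙 Y))
    (hm1 : eigenMultiplicity Y φ (Complex.I * (Real.sqrt d : ℂ)) = 1 ∨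
      eigenMultiplicity Y φ (-(Complex.I * (Real.sqrt d : ℂ))) = 1)
    (hE1 : E.dim = 1) (χ : E ⟶ E) {d' : ℕ} (hd' : 0 < d') (hχ : χ ≫ χ = -(d' • 𝟙 E))
    (hA : IsIsogenous A ((E.powSucc 2).prod Y)) : HodgeConjectureFor A.dim A.X :=
  hodgeConjectureFor_row21_of_markman hMark₄ hY3 hY2 φ hd hφ hm1 hE1 χ hd' hχ
    (hA.trans (isIsogenous_prod_comm (E.powSucc 2) Y))

/-- **The `HCOnClass` spelling of row 21 modulo Markman₄**: GRANTED the displayed binder, HC holds on the class of complex abelian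
varieties isogenous to some `Y × ((E × E) × E)` with `Y`, `E` as above (the isogeny classes of TABLE X row 21, together with the
non-interacting row-28 members `ℚ(χ) ≠ ℚ(φ)`). CONDITIONAL; HC / `HC_AV` NOT proved.
[claim: Markman2025SurveySecant, status: under-review] [cite: MoonenZarhin1999LowDim, Thm. 0.2 (1)] -/
theorem hcOnClass_row21_of_markman (hMark₄ : Markman2025_weilClasses_algebraic_abelianFourfold) :
    HCOnClass fun A ↦ ∃ (Y E : AbelianVariety ℂ) (φ : Y ⟶ Y) (d : ℕ) (χ : E ⟶ E) (d' : ℕ),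
      Y.dim = 3 ∧ Module.finrank ℚ Y.endAlgebra = 2 ∧ 0 < d ∧ φ ≫ φ = -(d • 𝟙 Y) ∧
      (eigenMultiplicity Y φ (Complex.I * (Real.sqrt d : ℂ)) = 1 ∨
        eigenMultiplicity Y φ (-(Complex.I * (Real.sqrt d : ℂ))) = 1) ∧
      E.dim = 1 ∧ 0 < d' ∧ χ ≫ χ = -(d' • 𝟙 E) ∧ IsIsogenous A (Y.prod ((E.prod E).prod E)) := by
  rintro A ⟨Y, E, φ, d, χ, d', hY3, hY2, hd, hφ, hm1, hE1, hd', hχ, hA⟩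
  exact hodgeConjectureFor_row21_of_markman hMark₄ hY3 hY2 φ hd hφ hm1 hE1 χ hd' hχ hA

/-- **Same field (`d = d'`, multiplicity `1` at the SAME eigenvalue on `Y` and on `E`): Markman enters only through the Weil
classes of the fourfold `Y × E_k` itself** — Moonen–Zarhin case (a1), `B•(Y × E_k) = D• + W_k`, the tree's
`hodgeConjectureFor_prod_cmCurve_of_unitaryTwoOne_of_weilClassesFourfold` (van Geemen's reduction Thm. 6.12) feeds §2 directly,
without the `dim ≤ 5` floor. CONDITIONAL on the displayed binder; HC / `HC_AV` NOT proved.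
[cite: MoonenZarhin1999LowDim, Thm. 0.1 (1) with case (a) and §5 (5.3)] [cite: vanGeemen1994HodgeAV, Thm. 6.12]
[claim: Markman2025SurveySecant, status: under-review] -/
theorem hodgeConjectureFor_unitaryTwoOne_prod_cmCurveCube_of_markman_sameField
    (hMark₄ : Markman2025_weilClasses_algebraic_abelianFourfold) (hY3 : Y.dim = 3)
    (hY2 : Module.finrank ℚ Y.endAlgebra = 2) (φ : Y ⟶ Y) {d : ℕ} (hd : 0 < d) (hφ : φ ≫ φ = -(d • 𝟙 Y)) {μ₀ : ℂ}
    (hμ₀ : μ₀ = Complex.I * (Real.sqrt d : ℂ) ∨ μ₀ = -(Complex.I * (Real.sqrt d : ℂ)))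
    (hmY : eigenMultiplicity Y φ μ₀ = 1) (hE1 : E.dim = 1) (χ : E ⟶ E) (hχ : χ ≫ χ = -(d • 𝟙 E))
    (hmE : eigenMultiplicity E χ μ₀ = 1) :
    HodgeConjectureFor (Y.prod ((E.prod E).prod E)).dim (Y.prod ((E.prod E).prod E)).X := by
  have hm1 : eigenMultiplicity Y φ (Complex.I * (Real.sqrt d : ℂ)) = 1 ∨
      eigenMultiplicity Y φ (-(Complex.I * (Real.sqrt d : ℂ))) = 1 := by
    rcases hμ₀ with rfl | rfl
    · exact Or.inl hmY
    · exact Or.inr hmY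
  exact hodgeConjectureFor_unitaryTwoOne_prod_cmCurveCube_of_fourfold hY3 hY2 φ hd hφ hm1 hE1 χ hd hχ
    (hodgeConjectureFor_prod_cmCurve_of_unitaryTwoOne_of_weilClassesFourfold hMark₄ hY3 hY2 φ hd hφ hμ₀ hmY hE1 χ hχ hmE)

end Row21

/-! ## §4 Audit: on path -/

/-- Audit: every conclusion of this file is a case of the summit. [cite: Deligne2000, §1] -/
theorem hcOnClass_row21_of_hodgeConjecture (h : _root_.HodgeConjecture) :
    HCOnClass fun A ↦ ∃ (Y E : AbelianVariety ℂ) (φ : Y ⟶ Y) (d : ℕ) (χ : E ⟶ E) (d' : ℕ),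
      Y.dim = 3 ∧ Module.finrank ℚ Y.endAlgebra = 2 ∧ 0 < d ∧ φ ≫ φ = -(d • 𝟙 Y) ∧
      (eigenMultiplicity Y φ (Complex.I * (Real.sqrt d : ℂ)) = 1 ∨
        eigenMultiplicity Y φ (-(Complex.I * (Real.sqrt d : ℂ))) = 1) ∧
      E.dim = 1 ∧ 0 < d' ∧ χ ≫ χ = -(d' • 𝟙 E) ∧ IsIsogenous A (Y.prod ((E.prod E).prod E)) :=
  hcOnClass_of_hodgeConjecture _ h

end Summit.HodgeConjecture.HodgeConjecture.TableX.ProductRows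

end
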